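import Summits.ResolutionOfSingularities.ResolutionOfSingularities.Theorems.HilbertSamuelEliminationSigmaMaxModificationsCorridor3WLadderStrataLineages
import HarnessLib

/-!
# [OURS · L1 W4.2] The STRATA-half of the MOVING W-ladder, second layer (part 1/2): the LABEL BOOKKEEPING of
# CJS Rem. 6.29 (1) along canonical near steps, PROVED, and the rows (c-geo) / (c-rep)

Crux chain w42 (`SigmaMaxModifications`, stmt-ResolutionOfSingularities-18506; skeleton `w_ladder` v5 on
`SigmaMaxModificationsCorridor3`, stmt-ResolutionOfSingularities-19249), row «stub-4 successor → `Moving.Wlow3CharStrataM p`»,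
seat res-L1-w42-stub-4 (gen 3); companion of `…Corridor3WLadderStrataLineages` (p500484: strata-half ⟸ (b) ∧ (c)); part 2/2
(`…Corridor3WLadderStrataCentre`) proves row (c) `StrataLineagesFinite` from (c-geo) ∧ (c-rep) with the lemmas below.
OURS (cell res-hironaka, slot W4.2); NOT statements of H. Hironaka's manuscript [Hironaka2017] nor of
[CossartJannsenSaito2020]; AI-drafted, weaker than expert review. Every `theorem` is PROVED (no geometry, `ν ≠ Φ^{(N)}` not
needed); the open content is the two `def … : Prop` rows of §5. Helper file `--supports stmt-ResolutionOfSingularities-19249`.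

## What is typed / proved (namespaces `…Theorems.SigmaMaxModificationsCorridor3.Moving`, `…CampaignW42.CanonicalNearStep`)

* §1 `treatedLabel` (least non-empty label between cycles, the cycle's label inside a cycle), `pendingLength` (`0` between
  cycles, `1 +` the number of centres still to be replayed), `LabelInv` (labels `≤` year; inside a cycle for `j` every
  component present has label `≥ j` and `j ≤` year) with `labelInv_init`; `treatedLabel_le_label`, `treatedLabel_le_year`.
* §2 anatomy of ONE canonical near step: `CanonicalNearStep.year_eq`, `.label_cases` («dominates ⇒ inherits, otherwise the new
  year»), `.lbl_eq_treatedLabel` (a cycle starts with the least label and keeps it), `.pendingLength_eq_of_succ` (the pending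
  length drops by one), `support_eq_part_of_next_none` (the centre of a CYCLE-END step — next state `none` — is the whole treated
  part `Y_n^{(j)}`), `treatedLabel_le_of_step` (the treated label never decreases), `LabelInv.step` / `.of_reaches`.
* §3 `StepProjection.year_eq`, `.label_eq_of_mem`, `.mem_componentsIn_of_label_ne` — the label calculus read through the step
  projections of p500484 (sets on the ACTUAL stages of a chain).
* §5 ROWS (OPEN, OURS): (c-geo) `StrataLineageInCentreIO p N Q G` — no dominating lineage of stratum components through the
  chain points lies in the canonical centre at infinitely many stages (the dimension-two kernel: CJS Cor. 6.37 / Thm. 6.35 at the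
  generic point `η_Z`, Thm. 3.6, Prop. 6.31); (c-rep) `StrataReplayBlowupsSettle p N Q G` — from some stage on every blow-up of the
  chain point is a cycle end (replayed centres of later cycles miss the chain points: Rem. 6.29 (1) with Thm. 3.14).

References: CJS LNM 2270 Rem. 6.29 (1) pp. 91–92, Step 7 p. 95, p. 102, p. 105, p. 107, Thm. 3.6, Thm. 3.14, Prop. 6.31,
Thm. 6.35, Cor. 6.37 [CossartJannsenSaito2020]; tree `Literature…CanonicalEliminationSequence` (`Labelling`, `Pending`,
`IsReplayStep`, `IsCanonicalStep`), `…CampaignW42Tertiary`, `…Corridor3WLadderStrataLineages` (p500484); HOME/L/w42/CHAIN.md v3.7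
§0f; L/res-L1-w42-tri-1/TRIAGE.md v3 §R3 (R3-F′ (P2), R3-B2).
-/


noncomputable section

-- plan-1/idea-2 module setting kept (namespace `…Corridor3.Moving` re-enters `…Corridor3`)
set_option linter.dupNamespace false

open CategoryTheory AlgebraicGeometry TopologicalSpace Topology
open Summit.ResolutionOfSingularities.ResolutionOfSingularities.Theorems.CampaignW42
open Literature.AlgebraicGeometry.Resolution Literature.RingTheory.HilbertSamuel
open Literature.AlgebraicGeometry.CossartJannsenSaito2020
open Summit.ResolutionOfSingularities.ResolutionOfSingularities.Theorems.SigmaMaxModificationsCorridor3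

universe u

namespace Summit.ResolutionOfSingularities.ResolutionOfSingularities.Theorems.SigmaMaxModificationsCorridor3.Moving

variable {R : ∀ S : Scheme.{u}, CentreSeq S → Prop} {N : ℕ} {ν : ℕ → ℕ}

/-! ## §1. The treated label, the pending length, the label invariant -/

/-- [OURS · L1 W4.2] THE TREATED LABEL of a marked stage: between cycles (`P = none`) the least label `j` with `Y_n^{(j)} ≠ ∅`
(the label the next cycle treats, Step 7), inside a cycle (`P = some Q`) the cycle's label `Q.lbl`.
[cite: CossartJannsenSaito2020, Rem. 6.29 (1), proof of Thm. 6.28 Step 7] -/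
def treatedLabel (N : ℕ) (ν : ℕ → ℕ) (s : MarkedStage.{u}) : ℕ :=
  s.P.elim (sInf {i | (s.L.part (Scheme.hsStratum s.W N ν) i).Nonempty}) fun Q => Q.lbl

/-- [OURS · L1 W4.2] THE PENDING LENGTH of a marked stage: `0` between cycles, `1 +` the number of lower-dimensional centres
still to be replayed inside a cycle (so the cycle ends exactly when it reaches `0`). [cite: CossartJannsenSaito2020, Rem. 6.29 (1)] -/
def pendingLength (s : MarkedStage.{u}) : ℕ :=
  s.P.elim 0 fun Q => Q.rest.length + 1

/-- [OURS · L1 W4.2] THE LABEL INVARIANT of the states of `S(X, ν)`: labels are not newer than the year, and inside a resolution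
cycle for the label `j` every irreducible component of the stratum has label `≥ j` and `j ≤` year («we proceed with
`Y^{(1)}` … until … `Y^{(1)}` is empty, and proceed with `Y^{(2)}`, etc.»: smaller labels are exhausted before a cycle starts and
are never re-created). [cite: CossartJannsenSaito2020, Rem. 6.29 (1)] -/
structure LabelInv (N : ℕ) (ν : ℕ → ℕ) (s : MarkedStage.{u}) : Prop where
  /-- labels `≤` year -/
  label_le_year : ∀ Z, s.L.label Z ≤ s.L.year
  /-- inside a cycle for `j`, every component present has label `≥ j` -/
  lbl_le_label : ∀ Q, s.P = some Q → ∀ Z ∈ componentsIn (Scheme.hsStratum s.W N ν), Q.lbl ≤ s.L.label Z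
  /-- inside a cycle for `j`, `j ≤` year -/
  lbl_le_year : ∀ Q, s.P = some Q → Q.lbl ≤ s.L.year

/-- Unfolding, between cycles. [folklore] -/
theorem treatedLabel_of_none {s : MarkedStage.{u}} (h : s.P = none) :
    treatedLabel N ν s = sInf {i | (s.L.part (Scheme.hsStratum s.W N ν) i).Nonempty} := by
  simp [treatedLabel, h]

/-- Unfolding, inside a cycle. [folklore] -/
theorem treatedLabel_of_some {s : MarkedStage.{u}} {Q : Pending s.W} (h : s.P = some Q) : treatedLabel N ν s = Q.lbl := by
  simp [treatedLabel, h]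

/-- Unfolding, between cycles. [folklore] -/
theorem pendingLength_of_none {s : MarkedStage.{u}} (h : s.P = none) : pendingLength s = 0 := by
  simp [pendingLength, h]

/-- Unfolding, inside a cycle. [folklore] -/
theorem pendingLength_of_some {s : MarkedStage.{u}} {Q : Pending s.W} (h : s.P = some Q) :
    pendingLength s = Q.rest.length + 1 := by
  simp [pendingLength, h]

/-- The pending length vanishes exactly between cycles. [folklore] -/
theorem pendingLength_eq_zero_iff {s : MarkedStage.{u}} : pendingLength s = 0 ↔ s.P = none := by
  rcases h : s.P with _ | Q
  · simp [pendingLength, h]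
  · simp [pendingLength, h]

/-- The part carrying the label of a component is non-empty. [folklore] -/
theorem part_label_nonempty {W : Scheme.{u}} (L : Labelling W) {Y : Set W} {Z : Set W} (hZ : Z ∈ componentsIn Y) :
    (L.part Y (L.label Z)).Nonempty :=
  (componentsIn.nonempty hZ).mono (L.subset_part hZ rfl)

/-- **The treated label is `≤` the label of every component present.** [cite: CossartJannsenSaito2020, Rem. 6.29 (1)] -/
theorem treatedLabel_le_label {s : MarkedStage.{u}} (hinv : LabelInv N ν s) {Z : Set s.W}
    (hZ : Z ∈ componentsIn (Scheme.hsStratum s.W N ν)) : treatedLabel N ν s ≤ s.L.label Z := by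
  rcases h : s.P with _ | Q
  · rw [treatedLabel_of_none h]
    exact Nat.sInf_le (part_label_nonempty s.L hZ)
  · rw [treatedLabel_of_some h]
    exact hinv.lbl_le_label Q h Z hZ

/-- The treated label is `≤` the year (as soon as the stratum is non-empty). [cite: CossartJannsenSaito2020, Rem. 6.29 (1)] -/
theorem treatedLabel_le_year {s : MarkedStage.{u}} (hinv : LabelInv N ν s) (hne : (Scheme.hsStratum s.W N ν).Nonempty) :
    treatedLabel N ν s ≤ s.L.year := by
  rcases h : s.P with _ | Q
  · obtain ⟨y, hy⟩ := hne
    obtain ⟨Z, hZ, -⟩ := componentsIn.exists_mem hy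
    exact (treatedLabel_le_label hinv hZ).trans (hinv.label_le_year Z)
  · rw [treatedLabel_of_some h]
    exact hinv.lbl_le_year Q h

/-- The label invariant holds at an initial marked stage. [cite: CossartJannsenSaito2020, Rem. 6.29 (1)] -/
theorem labelInv_init (X : Scheme.{u}) [IsLocallyNoetherian X] (x : X) : LabelInv N ν (MarkedStage.init X x) where
  label_le_year _ := le_rfl
  lbl_le_label Q h := by cases h
  lbl_le_year Q h := by cases h

/-! ## §2. Anatomy of one canonical near step -/

end Summit.ResolutionOfSingularities.ResolutionOfSingularities.Theorems.SigmaMaxModificationsCorridor3.Moving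

namespace Summit.ResolutionOfSingularities.ResolutionOfSingularities.Theorems.CampaignW42.CanonicalNearStep

open Summit.ResolutionOfSingularities.ResolutionOfSingularities.Theorems.SigmaMaxModificationsCorridor3.Moving

variable {R : ∀ S : Scheme.{u}, CentreSeq S → Prop} {N : ℕ} {ν : ℕ → ℕ} {s s' : MarkedStage.{u}}

/-- Along a canonical near step the year goes up by one. [cite: CossartJannsenSaito2020, Rem. 6.29 (1)] -/
theorem year_eq (h : CanonicalNearStep R N ν s s') : s'.L.year = s.L.year + 1 := by
  obtain ⟨C, P', hln, x', -, -, -, -, rfl⟩ := h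
  rfl

/-- **«Dominates ⇒ inherits; otherwise the new label»**: after a canonical near step every label is either the new year or the
label of an irreducible component of the previous stratum. [cite: CossartJannsenSaito2020, Rem. 6.29 (1)] -/
theorem label_cases (h : CanonicalNearStep R N ν s s') (Z' : Set s'.W) :
    s'.L.label Z' = s.L.year + 1 ∨ ∃ Z ∈ componentsIn (Scheme.hsStratum s.W N ν), s'.L.label Z' = s.L.label Z := by
  obtain ⟨C, P', hln, x', -, -, -, -, rfl⟩ := h
  by_cases hZ : closure (blowup.π C '' Z') ∈ componentsIn (Scheme.hsStratum s.W N ν)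
  · exact Or.inr ⟨_, hZ, s.L.next_label_of_mem C hZ⟩
  · exact Or.inl (s.L.next_label_of_not_mem C hZ)

/-- **Inside a cycle the label treated is the treated label of the previous stage**: if the next state is `some Q'` then
`Q'.lbl = treatedLabel s` (a cycle starts with the least non-empty label; a cycle keeps its label).
[cite: CossartJannsenSaito2020, Rem. 6.29 (1), proof of Thm. 6.28 Step 7] -/
theorem lbl_eq_treatedLabel (h : CanonicalNearStep R N ν s s') {Q' : Pending s'.W} (h' : s'.P = some Q') :
    Q'.lbl = treatedLabel N ν s := by
  obtain ⟨C, P', hln, x', hcs, -, -, -, rfl⟩ := h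
  change P' = some Q' at h'
  rcases hsP : s.P with _ | Q
  · rw [treatedLabel_of_none hsP]
    rw [hsP] at hcs
    obtain ⟨j, hj, hcl, t, -, hrep⟩ := hcs
    rw [hj.csInf_eq]
    cases t with
    | nil _ =>
      obtain ⟨-, hnone⟩ := hrep
      rw [hnone] at h'
      exact absurd h' (by simp)
    | cons D t' =>
      obtain ⟨-, φ', hφ', -, hsome⟩ := hrep
      rw [hsome] at h'
      cases h'
      rfl
  · rw [treatedLabel_of_some hsP]
    rw [hsP] at hcs
    obtain ⟨-, hrep⟩ := hcs
    generalize hr : Q.rest = r at hrep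
    cases r with
    | nil _ =>
      obtain ⟨-, hnone⟩ := hrep
      rw [hnone] at h'
      exact absurd h' (by simp)
    | cons D t' =>
      obtain ⟨-, φ', hφ', -, hsome⟩ := hrep
      rw [hsome] at h'
      cases h'
      rfl

/-- **Inside a cycle the pending length drops by one at each step** (and reaches `0` = `none` at the cycle's end).
[cite: CossartJannsenSaito2020, Rem. 6.29 (1)] -/
theorem pendingLength_eq_of_succ (h : CanonicalNearStep R N ν s s') {k : ℕ} (hk : pendingLength s = k + 1) :
    pendingLength s' = k := by
  obtain ⟨C, P', hln, x', hcs, -, -, -, rfl⟩ := h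
  rcases hsP : s.P with _ | Q
  · rw [pendingLength_of_none hsP] at hk
    exact absurd hk (by omega)
  · rw [pendingLength_of_some hsP] at hk
    rw [hsP] at hcs
    obtain ⟨-, hrep⟩ := hcs
    generalize hr : Q.rest = r at hrep hk
    cases r with
    | nil _ =>
      obtain ⟨-, hnone⟩ := hrep
      have h0 := pendingLength_of_none (s := ⟨blowup C, hln, s.L.next (Scheme.hsStratum s.W N ν) C, P', x'⟩) hnone
      simp only [CentreSeq.length_nil, zero_add] at hk
      omega
    | cons D t' =>
      obtain ⟨-, φ', hφ', -, hsome⟩ := hrep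
      have h1 := pendingLength_of_some (s := ⟨blowup C, hln, s.L.next (Scheme.hsStratum s.W N ν) C, P', x'⟩) hsome
      dsimp only at h1
      simp only [CentreSeq.length_cons] at hk
      omega

end Summit.ResolutionOfSingularities.ResolutionOfSingularities.Theorems.CampaignW42.CanonicalNearStep

namespace Summit.ResolutionOfSingularities.ResolutionOfSingularities.Theorems.SigmaMaxModificationsCorridor3.Moving

variable {R : ∀ S : Scheme.{u}, CentreSeq S → Prop} {N : ℕ} {ν : ℕ → ℕ}

/-- **The centre of a CYCLE-END step is the whole treated part**: if the canonical near step `s → s'` leads to a state between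
cycles (`s'.P = none`), the centre of THE canonical step from `s` (functional oracle) has support `Y_n^{(j)}`, `j` the treated label
of `s` («Then we blow up `Y_{m_0}^{(0)}`»). [cite: CossartJannsenSaito2020, Rem. 6.29 (1)] -/
theorem support_eq_part_of_next_none (hRf : OracleFunctional R) {s s' : MarkedStage.{u}} (h : CanonicalNearStep R N ν s s')
    (hnone : s'.P = none) {C : s.W.IdealSheafData} {P' : Option (Pending (blowup C))}
    (hcs : IsCanonicalStep R N ν s.L s.P C P') :
    (C.support : Set s.W) = s.L.part (Scheme.hsStratum s.W N ν) (treatedLabel N ν s) := by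
  obtain ⟨C₀, P₀, hln, x', hcs₀, -, -, -, rfl⟩ := h
  change P₀ = none at hnone
  subst hnone
  obtain rfl : C = C₀ := hcs.centre_unique hRf hcs₀
  rcases hsP : s.P with _ | Q
  · rw [treatedLabel_of_none hsP]
    rw [hsP] at hcs₀
    obtain ⟨j, hj, hcl, t, -, hrep⟩ := hcs₀
    rw [hj.csInf_eq]
    cases t with
    | nil _ => exact hrep.support_eq_part
    | cons D t' =>
      obtain ⟨-, φ', hφ', -, hsome⟩ := hrep
      exact absurd hsome (by simp)
  · rw [treatedLabel_of_some hsP]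
    rw [hsP] at hcs₀
    obtain ⟨-, hrep⟩ := hcs₀
    generalize hr : Q.rest = r at hrep
    cases r with
    | nil _ => exact hrep.support_eq_part
    | cons D t' =>
      obtain ⟨-, φ', hφ', -, hsome⟩ := hrep
      exact absurd hsome (by simp)

/-- **The treated label does not decrease along a canonical near step** (as long as the procedure goes on, i.e. the new stratum is
non-empty): a cycle keeps its label; after a cycle end every label present is inherited (`≥` the old treated label) or the new
year. [cite: CossartJannsenSaito2020, Rem. 6.29 (1), proof of Thm. 6.28 Step 7] -/
theorem treatedLabel_le_of_step {s s' : MarkedStage.{u}} (hinv : LabelInv N ν s) (h : CanonicalNearStep R N ν s s')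
    (hne : (Scheme.hsStratum s'.W N ν).Nonempty) : treatedLabel N ν s ≤ treatedLabel N ν s' := by
  have hneY : (Scheme.hsStratum s.W N ν).Nonempty := by
    obtain ⟨C, P', hln, x', hcs, -, -, -, -⟩ := h
    exact hcs.hsStratum_nonempty
  rcases hs'P : s'.P with _ | Q'
  · rw [treatedLabel_of_none hs'P]
    -- every non-empty label at `s'` is `≥ treatedLabel s`
    have hS : {i | (s'.L.part (Scheme.hsStratum s'.W N ν) i).Nonempty}.Nonempty := by
      obtain ⟨y, hy⟩ := hne
      obtain ⟨Z', hZ', -⟩ := componentsIn.exists_mem hy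
      exact ⟨_, part_label_nonempty s'.L hZ'⟩
    obtain ⟨y, hy⟩ := Nat.sInf_mem hS
    obtain ⟨Z', hZ', hl, -⟩ := (s'.L.mem_part_iff _ _ y).mp hy
    rw [← hl]
    rcases h.label_cases Z' with hnew | ⟨Z, hZ, hold⟩
    · rw [hnew]
      exact (treatedLabel_le_year hinv hneY).trans (Nat.le_succ _)
    · rw [hold]
      exact treatedLabel_le_label hinv hZ
  · rw [treatedLabel_of_some hs'P, h.lbl_eq_treatedLabel hs'P]

/-- **The label invariant propagates along canonical near steps.** [cite: CossartJannsenSaito2020, Rem. 6.29 (1)] -/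
theorem LabelInv.step {s s' : MarkedStage.{u}} (hinv : LabelInv N ν s) (h : CanonicalNearStep R N ν s s') :
    LabelInv N ν s' := by
  have hneY : (Scheme.hsStratum s.W N ν).Nonempty := by
    obtain ⟨C, P', hln, x', hcs, -, -, -, -⟩ := h
    exact hcs.hsStratum_nonempty
  have hyear := h.year_eq
  refine ⟨fun Z' => ?_, fun Q' hQ' Z' hZ' => ?_, fun Q' hQ' => ?_⟩
  · rcases h.label_cases Z' with hnew | ⟨Z, -, hold⟩
    · rw [hnew, hyear]
    · rw [hold, hyear]
      exact (hinv.label_le_year Z).trans (Nat.le_succ _)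
  · rw [h.lbl_eq_treatedLabel hQ']
    rcases h.label_cases Z' with hnew | ⟨Z, hZ, hold⟩
    · rw [hnew]
      exact (treatedLabel_le_year hinv hneY).trans (Nat.le_succ _)
    · rw [hold]
      exact treatedLabel_le_label hinv hZ
  · rw [h.lbl_eq_treatedLabel hQ', hyear]
    exact (treatedLabel_le_year hinv hneY).trans (Nat.le_succ _)

/-- … and along `Reaches`. [folklore] -/
theorem LabelInv.of_reaches {s s' : MarkedStage.{u}} (hinv : LabelInv N ν s) (hr : Reaches R N ν s s') :
    LabelInv N ν s' := by
  induction hr with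
  | refl => exact hinv
  | tail _ hlast ih => exact ih.step hlast

/-! ## §3. Labels along step projections: «dominates ⇒ inherits» for sets on the actual stages -/

namespace StepProjection

variable {s s' : MarkedStage.{u}} {f : s'.W ⟶ s.W}

/-- The year goes up by one. [cite: CossartJannsenSaito2020, Rem. 6.29 (1)] -/
theorem year_eq (hf : StepProjection R N ν s s' f) : s'.L.year = s.L.year + 1 :=
  hf.canonicalNearStep.year_eq

/-- **«Dominates ⇒ inherits»** read through a step projection: if the closure of the image of `Z' ⊆ X_{n+1}` under the
blow-down is an irreducible component `Z` of `X_n(ν)`, the label of `Z'` is the label of `Z`. [cite: CossartJannsenSaito2020, Rem. 6.29 (1)] -/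
theorem label_eq_of_mem (hf : StepProjection R N ν s s' f) {Z' : Set s'.W}
    (hZ : closure (f.base '' Z') ∈ componentsIn (Scheme.hsStratum s.W N ν)) :
    s'.L.label Z' = s.L.label (closure (f.base '' Z')) := by
  obtain ⟨C, P', hln, x', -, -, -, -, e, rfl⟩ := hf
  subst e
  simp only [eqToHom_refl, Category.id_comp] at hZ ⊢
  exact s.L.next_label_of_mem C hZ

/-- **«Otherwise it gets the label `n + 1`»**, contrapositive: a set whose label is NOT the new year dominates an irreducible
component of the previous stratum. [cite: CossartJannsenSaito2020, Rem. 6.29 (1)] -/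
theorem mem_componentsIn_of_label_ne (hf : StepProjection R N ν s s' f) {Z' : Set s'.W}
    (hne : s'.L.label Z' ≠ s.L.year + 1) : closure (f.base '' Z') ∈ componentsIn (Scheme.hsStratum s.W N ν) := by
  obtain ⟨C, P', hln, x', -, -, -, -, e, rfl⟩ := hf
  subst e
  simp only [eqToHom_refl, Category.id_comp]
  by_contra hZ
  exact hne (s.L.next_label_of_not_mem C hZ)

end StepProjection

/-! ## §5. The rows (c-geo) and (c-rep) (OPEN; the reduction of row (c) to them is part 2/2) -/

/-- [OURS · L1 W4.2] **ROW (c-geo) — THE DIMENSION-TWO KERNEL: no dominating lineage through the chain points lies in the centre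
infinitely often.** For every functional admissible oracle, value `ν`, `Q`-maximal origin of characteristic `p` at level `N` and
every MOVING, NEVER-ISOLATED `G`-chain `x_n ∈ X_n(ν)` from it: there is no sequence `Z_n ∋ x_n` of irreducible components of the
`X_n(ν)` with `Z_{n+1}` dominating `Z_n` for every `n` AND `Z_n` contained in the centre of the canonical step from `X_n` for
infinitely many `n`. Intended proof (`G = (ē ≤ 2)`): at the generic point `η = η_{Z_n}` such a lineage is an infinite sequence of
closed-point blow-ups with near points of the excellent local ring `𝒪_{X_n,η}` of dimension `≤ 2` (Prop. 6.31; the steps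
between two of them are isomorphisms at `η`), where `e_η ≤ e_{x_n} − 1 ≤ 1` (Thm. 3.6, the centre being permissible through
`x_n`) — excluded by Cor. 6.37 / Thm. 6.35, theorems in EVERY characteristic in dimension two (Thm. 3.14 holds at `η`:
`char ≥ dim/2 + 1` reads `char ≥ 2`). OURS row, OPEN; NOT a statement of the manuscript.
[cite: CossartJannsenSaito2020, Prop. 6.31, Thm. 3.6, Cor. 6.37, Thm. 6.35] -/
def StrataLineageInCentreIO (p N : ℕ) (Q : ℕ → (ℕ → ℕ) → ∀ X : Scheme.{u}, X → Prop) (G : MarkedStage.{u} → Prop) : Prop :=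
  ∀ (R : ∀ S : Scheme.{u}, CentreSeq S → Prop), OracleFunctional R → OracleAdmissible R →
  ∀ (ν : ℕ → ℕ) (X : Scheme.{u}) [IsLocallyNoetherian X] (x : X), IsMaximalOrigin p N ν X x → Q N ν X x →
  ∀ c : ℕ → MarkedStage.{u}, Reaches R N ν (MarkedStage.init X x) (c 0) →
    (∀ n, CanonicalNearStep R N ν (c n) (c (n + 1))) → (∀ n, G (c n)) → (∀ n, ¬ Iso N (c n)) →
    (∀ n, ∃ m, n ≤ m ∧ (c m).IsBlownUp R N ν) →
    ¬ ∃ Z : ∀ n, Set (c n).W, (∀ n, Z n ∈ componentsThrough N ν (c n)) ∧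
        (∀ n, ∃ f : (c (n + 1)).W ⟶ (c n).W, StepProjection R N ν (c n) (c (n + 1)) f ∧
          closure (f.base '' Z (n + 1)) = Z n) ∧
        ∀ n, ∃ m, n ≤ m ∧ ∃ (C : (c m).W.IdealSheafData) (P' : Option (Pending (blowup C))),
          IsCanonicalStep R N ν (c m).L (c m).P C P' ∧ Z m ⊆ (C.support : Set (c m).W)

/-- [OURS · L1 W4.2] **ROW (c-rep) — REPLAY BLOW-UPS OF THE CHAIN POINT SETTLE.** In the same scope: from some stage on, whenever
the marked point `x_n` lies in the canonical centre, the step is a CYCLE END (the next state is between cycles,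
`(c (n+1)).P = none`; its centre is then the whole treated part `Y_n^{(j)}`, `support_eq_part_of_next_none`) — the chain point is
no longer hit by REPLAYED lower-dimensional centres. Intended proof (`G = (ē ≤ 2)`): replayed centres of a cycle lie over the
non-regular locus of the part at the cycle's start (admissible oracle); after the first cycles of the finitely many early labels,
the part treated is, near the chain point, ONE regular curve (the dominating near curve `Z ≅ D` over a regular curve through a
point with `ē ≤ 2`: Thm. 3.6, Thm. 3.14, finite birational onto regular), so its non-regular locus misses every later chain
point. OURS row, OPEN; NOT a statement of the manuscript. [cite: CossartJannsenSaito2020, Rem. 6.29 (1), Thm. 3.14, Thm. 3.6] -/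
def StrataReplayBlowupsSettle (p N : ℕ) (Q : ℕ → (ℕ → ℕ) → ∀ X : Scheme.{u}, X → Prop) (G : MarkedStage.{u} → Prop) : Prop :=
  ∀ (R : ∀ S : Scheme.{u}, CentreSeq S → Prop), OracleFunctional R → OracleAdmissible R →
  ∀ (ν : ℕ → ℕ) (X : Scheme.{u}) [IsLocallyNoetherian X] (x : X), IsMaximalOrigin p N ν X x → Q N ν X x →
  ∀ c : ℕ → MarkedStage.{u}, Reaches R N ν (MarkedStage.init X x) (c 0) →
    (∀ n, CanonicalNearStep R N ν (c n) (c (n + 1))) → (∀ n, G (c n)) → (∀ n, ¬ Iso N (c n)) →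
    (∀ n, ∃ m, n ≤ m ∧ (c m).IsBlownUp R N ν) →
    ∃ n₁, ∀ n, n₁ ≤ n → (c n).IsBlownUp R N ν → (c (n + 1)).P = none

end Summit.ResolutionOfSingularities.ResolutionOfSingularities.Theorems.SigmaMaxModificationsCorridor3.Moving

end
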